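import Summits.Ventures.YMGap.Thresholds.TwistedBochnerSU3Trace
import Summits.Ventures.YMGap.Thresholds.OneLinkVarianceSDCentred
import Summits.Ventures.YMGap.Thresholds.OneLinkModulusSU3Twisted
import HarnessLib

/-!
# Venture YMGap — the `SU(3)` one-link modulus on the TRACE-NORM twisted Poincaré constant: `K_PV2Tr(R) = √(v_PV2(3,R)/K₃(R))`,
# `K₃(R) = 12/7 − (64/35)R`, hypothesis-free; `SU(3)` instances at the cell's radii

HONEST FRAMING.  Venture file of the cell `pub-ymgap` (QuantumFields programme), seat engine-2 (g12); 0 compute.  Explicit STRONG-COUPLING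
constants for lattice `SU(3)` Yang–Mills (small `β`); NOT weak coupling, NOT a continuum statement, NOT a Yang–Mills mass-gap claim.

WHAT.  g11's `OneLinkModulusSU3Twisted` verbatim with the twisted Poincaré constant of `TwistedBochnerSU3Trace.oneLinkPoincareSUN_su3_twisted_tr`
(`0 < K_p`, `K_p + (64/35)R ≤ 12/7`; g11: `(97/50)R`) in place of `oneLinkPoincareSUN_su3_twisted`: pub-balaban's door `K = √(c·v)` with `c = 1/K_p` and
engine-2 g10's centred Schwinger–Dyson variance `v = K_p K²`, `48τ(τ−1) + 27τ³R² ≤ 16(τ−1)K_pK²`, gives `su3_oneLinkKRModulus_pv2tr_of_le :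
OneLinkKRModulus 3 R K`, the off-column input (g11's `su3_sqrt_cP_twisted_le`, reused) and the packaged robust-door inputs `su3_pv2tr_star_inputs`.
`SU(3)` INSTANCES (exact-rational certificates `HOME/pub-ymgap-engine-2/pv2tr/cert_pv2tr.json`; in brackets g11's `K_PV2T`): `R = 1/5`: `17509/10000`
(`1.7655`); `1/4`: `9463/5000 = 1.8926` (`1.9139`); `3/10`: `10263/5000 = 2.0526` (`2.0827`); `11/30`: `23001/10000` (`2.3465`; CERTIFIED given H1 ∧ H2: `7/5`);
`2/5`: `6103/2500 = 2.4412` (`2.4986`); `1/2`: `14779/5000 = 2.9558` (`3.0644`); `3/5`: `9179/2500 = 3.6716` (`3.888`); `27/100`: `9771/5000` (`1.9788`).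
Track (a) `ImprovedThreshold 4 3 (9/200)` does NOT move (`23/500` needs `4K(69/250)·23/500 ≤ 9/25`, here `0.363`).
NOT CLAIMED: anything for `SU(2)` or `N ≥ 4`; the certified column; sharpness.

References: Shen–Zhu–Zhu CMP 400 (2023) Thm. 1.2, Cor. 1.6, Lemma 4.1; H. Föllmer LNM 1362 (1988) Thm. (2.13); the tree:
`Thresholds/TwistedBochnerSU3Trace.lean` (engine-2 g12), `Thresholds/OneLinkVarianceSDCentred.lean` (engine-2 g10), g11's `Thresholds/OneLinkModulusSU3Twisted.lean`.
-/

noncomputable section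

open Literature.MathematicalPhysics.QuantumFieldTheory
open Literature.MathematicalPhysics.QuantumFieldTheory.Balaban1983to89.StrongCouplingDobrushinWindow (OneLinkKRModulus)
open Summit.QuantumFields.BalabanUV.InfraRed.StrongCouplingVarianceDoorSUN (OneLinkVarianceBound)
open Summit.QuantumFields.BalabanUV.InfraRed.StrongCouplingPoincareDoorSUN (OneLinkPoincareSUN oneLinkKRModulus_of_poincare_of_varianceBound)
open Summit.Ventures.YMGap.OneLinkVarianceSDC (su3_oneLinkVarianceBound_sdc_of_le)

namespace Summit.Ventures.YMGap.TwistedBochner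

/-! ### 1. The modulus on the twisted constant -/

/-- **`SU(3)` twisted inputs**: the Poincaré constant `1/K_p` (`0 < K_p`, `K_p + (64/35)R ≤ 12/7`) and the centred Schwinger–Dyson variance in the
enveloped form `v = K_p K²` (`48τ(τ−1) + 27τ³R² ≤ 16(τ−1)K_pK²`), so that `√(c·v) = K`. [folklore] -/
theorem su3_twisted_tr_pair {R τ K Kp : ℝ} (hτ : 1 < τ) (hKp : 0 < Kp) (hKpR : Kp + 64 / 35 * R ≤ 12 / 7) (hK0 : 0 ≤ K)
    (hK : 48 * τ * (τ - 1) + 27 * τ ^ 3 * R ^ 2 ≤ 16 * (τ - 1) * (Kp * K ^ 2)) :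
    OneLinkPoincareSUN 3 R (1 / Kp) ∧ OneLinkVarianceBound 3 R (Kp * K ^ 2) ∧ Real.sqrt (1 / Kp * (Kp * K ^ 2)) = K := by
  refine ⟨oneLinkPoincareSUN_su3_twisted_tr hKp hKpR, su3_oneLinkVarianceBound_sdc_of_le hτ hK, ?_⟩
  have e : 1 / Kp * (Kp * K ^ 2) = K ^ 2 := by field_simp
  rw [e, Real.sqrt_sq hK0]

/-- **THE `SU(3)` MODULUS ON THE TWISTED CONSTANT, HYPOTHESIS-FREE**: for `τ > 1`, `0 < K_p`, `K_p + (64/35)R ≤ 12/7`, `K ≥ 0` with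
`48τ(τ−1) + 27τ³R² ≤ 16(τ−1)·K_p·K²`:  `OneLinkKRModulus 3 R K`  (`K ≥ K_PV2T(R;τ) = √(3(τ + 9τ³R²/(16(τ−1)))/K_p)`). [folklore] -/
theorem su3_oneLinkKRModulus_pv2tr_of_le {R τ K Kp : ℝ} (hτ : 1 < τ) (hKp : 0 < Kp) (hKpR : Kp + 64 / 35 * R ≤ 12 / 7) (hK0 : 0 ≤ K)
    (hK : 48 * τ * (τ - 1) + 27 * τ ^ 3 * R ^ 2 ≤ 16 * (τ - 1) * (Kp * K ^ 2)) : OneLinkKRModulus 3 R K := by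
  obtain ⟨hP, hV, e⟩ := su3_twisted_tr_pair hτ hKp hKpR hK0 hK
  have h := oneLinkKRModulus_of_poincare_of_varianceBound (by positivity) (by positivity) hP hV
  rw [e] at h
  exact h

/-- **The PV2T door inputs for `SU(3)`** (consumed by the robust-star row files): with `τ > 1`, `0 < K_p`, `K_p + (64/35)R ≤ 12/7`, rational
majorants `K_s ≥ 0`, `48τ(τ−1) + 27τ³R² ≤ 16(τ−1)K_pK_s²`, `S_q ≥ 0`, `K_p S_q² ≥ 1`, `e^{ε₀} ≤ E`, `e^{ε₀/2} ≤ E₂`: the twisted Poincaré constant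
`c_P = 1/K_p`, the centred Schwinger–Dyson variance bound `v = K_p K_s²`, and the two enveloped door inputs `e^{ε₀}√(c_P v)·x ≤ E K_s x`,
`e^{ε₀/2}√c_P·ε₁ ≤ E₂ S_q ε₁`. [folklore] -/
theorem su3_pv2tr_star_inputs {R ε₀ ε₁ E E₂ τ Ks Sq Kp x : ℝ} (hτ : 1 < τ) (hKp : 0 < Kp) (hKpR : Kp + 64 / 35 * R ≤ 12 / 7)
    (hε₁ : 0 ≤ ε₁) (hx : 0 ≤ x) (hE : Real.exp ε₀ ≤ E) (hE₂ : Real.exp (ε₀ / 2) ≤ E₂) (hKs0 : 0 ≤ Ks)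
    (hKs : 48 * τ * (τ - 1) + 27 * τ ^ 3 * R ^ 2 ≤ 16 * (τ - 1) * (Kp * Ks ^ 2)) (hSq0 : 0 ≤ Sq) (hSq : 1 ≤ Kp * Sq ^ 2) :
    OneLinkPoincareSUN 3 R (1 / Kp) ∧ OneLinkVarianceBound 3 R (Kp * Ks ^ 2) ∧
      Real.exp ε₀ * Real.sqrt (1 / Kp * (Kp * Ks ^ 2)) * x ≤ E * Ks * x ∧
      Real.exp (ε₀ / 2) * Real.sqrt (1 / Kp) * ε₁ ≤ E₂ * Sq * ε₁ := by
  have hE0 : 0 ≤ E := (Real.exp_pos _).le.trans hE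
  have hE20 : 0 ≤ E₂ := (Real.exp_pos _).le.trans hE₂
  obtain ⟨hP, hV, hKs'⟩ := su3_twisted_tr_pair hτ hKp hKpR hKs0 hKs
  refine ⟨hP, hV, ?_, ?_⟩
  · rw [hKs']
    exact mul_le_mul_of_nonneg_right (mul_le_mul_of_nonneg_right hE hKs0) hx
  · exact mul_le_mul_of_nonneg_right (mul_le_mul hE₂ (su3_sqrt_cP_twisted_le hKp hSq0 hSq) (Real.sqrt_nonneg _) hE20) hε₁

/-! ### 2. `SU(3)` instances (one `norm_num` each; in brackets g11's `K_PV2T` on the Frobenius split) -/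

/-- `R = 1/5` (`β_W = 3/10` at the `d = 4` radius `2β_W/3`): `OneLinkKRModulus 3 (1/5) (17509/10000)` (`1.7509`; g11 `1.7655`; Bakry–Émery alone `10/3`). [folklore] -/
theorem su3_oneLinkKRModulus_pv2tr_oneFifth : OneLinkKRModulus 3 (1 / 5) (17509 / 10000) :=
  su3_oneLinkKRModulus_pv2tr_of_le (τ := 143 / 125) (Kp := 236 / 175) (by norm_num) (by norm_num) (by norm_num) (by norm_num) (by norm_num)

/-- `R = 1/4` (`β_W = 3/8`): `OneLinkKRModulus 3 (1/4) (9463/5000)` (`1.8926`; g11 `1.9139`). [folklore] -/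
theorem su3_oneLinkKRModulus_pv2tr_oneQuarter : OneLinkKRModulus 3 (1 / 4) (9463 / 5000) :=
  su3_oneLinkKRModulus_pv2tr_of_le (τ := 147 / 125) (Kp := 44 / 35) (by norm_num) (by norm_num) (by norm_num) (by norm_num) (by norm_num)

/-- `R = 3/10` (`β_W = 9/20`): `OneLinkKRModulus 3 (3/10) (10263/5000)` (`2.0526`; g11 `2.0827`). [folklore] -/
theorem su3_oneLinkKRModulus_pv2tr_threeTenths : OneLinkKRModulus 3 (3 / 10) (10263 / 5000) :=
  su3_oneLinkKRModulus_pv2tr_of_le (τ := 151 / 125) (Kp := 204 / 175) (by norm_num) (by norm_num) (by norm_num) (by norm_num) (by norm_num)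

/-- `R = 11/30` (the cell's star radius, `β_W = 11/20`): `OneLinkKRModulus 3 (11/30) (23001/10000)` (`2.3001`; g11 `2.3465`; the CERTIFIED constant given
H1 ∧ H2 is `7/5`). [folklore] -/
theorem su3_oneLinkKRModulus_pv2tr_elevenThirtieths : OneLinkKRModulus 3 (11 / 30) (23001 / 10000) :=
  su3_oneLinkKRModulus_pv2tr_of_le (τ := 311 / 250) (Kp := 548 / 525) (by norm_num) (by norm_num) (by norm_num) (by norm_num) (by norm_num)

/-- `R = 2/5` (`β_W = 3/5`): `OneLinkKRModulus 3 (2/5) (6103/2500)` (`2.4412`; g11 `2.4986`). [folklore] -/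
theorem su3_oneLinkKRModulus_pv2tr_twoFifths : OneLinkKRModulus 3 (2 / 5) (6103 / 2500) :=
  su3_oneLinkKRModulus_pv2tr_of_le (τ := 631 / 500) (Kp := 172 / 175) (by norm_num) (by norm_num) (by norm_num) (by norm_num) (by norm_num)

/-- `R = 1/2` (`β_W = 3/4`; Bakry–Émery's cap): `OneLinkKRModulus 3 (1/2) (14779/5000)` (`2.9558`; g11 `3.0644`). [folklore] -/
theorem su3_oneLinkKRModulus_pv2tr_oneHalf : OneLinkKRModulus 3 (1 / 2) (14779 / 5000) :=
  su3_oneLinkKRModulus_pv2tr_of_le (τ := 163 / 125) (Kp := 4 / 5) (by norm_num) (by norm_num) (by norm_num) (by norm_num) (by norm_num)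

/-- `R = 3/5` (the cell's area-law radius, `β_W = 9/10`): `OneLinkKRModulus 3 (3/5) (9179/2500)` (`3.6716`; g11 `3.888`; the CERTIFIED pair at this radius
reads `√((4/5)(17/5)) = 1.65`). [folklore] -/
theorem su3_oneLinkKRModulus_pv2tr_threeFifths : OneLinkKRModulus 3 (3 / 5) (9179 / 2500) :=
  su3_oneLinkKRModulus_pv2tr_of_le (τ := 67 / 50) (Kp := 108 / 175) (by norm_num) (by norm_num) (by norm_num) (by norm_num) (by norm_num)

/-- `R = 27/100` (the track-(a) radius `6 · (9/200)`): `OneLinkKRModulus 3 (27/100) (9771/5000)` (`1.9542`; g11 `1.9788`). [folklore] -/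
theorem su3_oneLinkKRModulus_pv2tr_r27 : OneLinkKRModulus 3 (27 / 100) (9771 / 5000) :=
  su3_oneLinkKRModulus_pv2tr_of_le (τ := 119 / 100) (Kp := 1068 / 875) (by norm_num) (by norm_num) (by norm_num) (by norm_num) (by norm_num)

end Summit.Ventures.YMGap.TwistedBochner

end
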